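import Summits.CriticalPhenomena.CardyFormulaZ2.Theorems.CardyFlipRussoVoronoiHubFromSmirnovBlackRegionCells

/-!
# Stub `blackPath_cellChain` of line `moebius-exact-delaunay-dilation-ward`
# (crux `VoronoiHubFromSmirnov`, stmt-CriticalPhenomena-6433)

**A black path runs through a finite chain of black cells** (Bollobás–Riordan, *Percolation*
(CUP 2006), Ch. 8 §8.1, "black clusters of the Voronoi tessellation ↔ open clusters of the
Delaunay graph").

The crux's crossing event is a continuum statement: a continuous path `γ` inside the black region
`blackRegion B W` of the nucleus sets `(B, W)` (black nuclei `B`, white nuclei `W`).  Comparing it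
across two cell geometries, or exploring it cell by cell, needs its combinatorial form: for `B`
locally finite (finite intersection with every compact set) and `B`, `W` nonempty there are black
nuclei `b 0, …, b k ∈ B` with `x ∈ cell (b 0)`, `y ∈ cell (b k)` and consecutive cells — closed
Voronoi cells with respect to ALL the nuclei `B ∪ W` — sharing a point of the path.

Proof (connectedness, instead of last-exit times).  Let `E b b'` ("adjacent") mean: `b, b' ∈ B`
and the cells of `b` and `b'` share a point of `γ`.  For parameters `s, s'` of the extended path
`γ.extend : ℝ → ℂ` put `P s s'` := every black cell containing `γ.extend s` is joined by an
`E`-chain (`Relation.ReflTransGen E`) to every black cell containing `γ.extend s'`.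
* `P` is transitive, because every path point lies in SOME black cell
  (`mem_blackRegion_iff_exists_voronoiCell`, landed).
* `P s s'` and `P s' s` hold for `s'` near `s` (`bpc_eventually_mem_voronoiCell`): only finitely
  many black cells come near the point `z := γ.extend s` (a cell point `w` with `dist w z < 1`
  has its nucleus within `2 + dist z b₁` of `z`, `b₁ ∈ B` fixed, by the cell inequality against
  `b₁`), the cells are closed, so near `z` a black cell containing `w` already contains `z`; then
  the two cells in question share the path point `γ.extend s` and are adjacent.
* `ℝ` is connected, so `P 0 1` (`PreconnectedSpace.induction₂'`): a black cell containing
  `x = γ.extend 0` is chained to a black cell containing `y = γ.extend 1`; unfolding the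
  reflexive-transitive closure into a `Fin (k+1)`-indexed tuple (`bpc_chain_of_reflTransGen`)
  gives the chain.

No new definitions; Mathlib only (`PreconnectedSpace.induction₂'`, `Set.Finite.eventually_all`,
`isCompact_closedBall`, `Path.extend_range`, `Fin.cons`, `Fin.lastCases`).
-/

noncomputable section

namespace Summit.CriticalPhenomena.CardyFormulaZ2.Cruxes.VoronoiHubFromSmirnov.MoebiusExactDelaunayDilationWard

open Set Metric Filter Topology

open Literature.Probability.LatticeModels (voronoiCell mem_voronoiCell_iff)

/-- **Voronoi cells are closed**: `voronoiCell ω p = ⋂ q ∈ ω, {x | dist x p ≤ dist x q}` is an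
intersection of closed sets. -/
theorem bpc_isClosed_voronoiCell {X : Type*} [PseudoMetricSpace X] (ω : Set X) (p : X) :
    IsClosed (voronoiCell ω p) := by
  have e : voronoiCell ω p = ⋂ q ∈ ω, {x : X | dist x p ≤ dist x q} := by
    ext x; simp only [mem_voronoiCell_iff, mem_iInter, mem_setOf_eq]
  rw [e]
  exact isClosed_biInter fun q _ =>
    isClosed_le (continuous_id.dist continuous_const) (continuous_id.dist continuous_const)

/-- **Black cells are locally finite**: for `B` locally finite and nonempty (and `W` arbitrary),
near any point `z` a cell `voronoiCell (B ∪ W) b` with black nucleus `b ∈ B` that contains a point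
`w` already contains `z`.  Indeed a cell point `w` with `dist w z < 1` satisfies
`dist w b ≤ dist w b₁` for a fixed `b₁ ∈ B`, whence `dist b z ≤ 2 + dist z b₁`: only the finitely
many black nuclei of that closed ball matter, and each of their (closed) cells not containing `z`
misses a neighbourhood of `z`. -/
theorem bpc_eventually_mem_voronoiCell {B : Set ℂ} (W : Set ℂ)
    (hB : ∀ K : Set ℂ, IsCompact K → (B ∩ K).Finite) (hBne : B.Nonempty) (z : ℂ) :
    ∀ᶠ w in 𝓝 z, ∀ b ∈ B, w ∈ voronoiCell (B ∪ W) b → z ∈ voronoiCell (B ∪ W) b := by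
  obtain ⟨b₁, hb₁⟩ := hBne
  have hFfin : (B ∩ closedBall z (2 + dist z b₁)).Finite := hB _ (isCompact_closedBall _ _)
  have h1 : ∀ᶠ w in 𝓝 z, ∀ b ∈ B ∩ closedBall z (2 + dist z b₁),
      w ∈ voronoiCell (B ∪ W) b → z ∈ voronoiCell (B ∪ W) b := by
    refine hFfin.eventually_all.2 fun b _ => ?_
    by_cases hz : z ∈ voronoiCell (B ∪ W) b
    · exact Eventually.of_forall fun _ _ => hz
    · exact mem_of_superset ((bpc_isClosed_voronoiCell (B ∪ W) b).isOpen_compl.mem_nhds hz)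
        fun w hw hw' => absurd hw' hw
  have h2 : ∀ᶠ w in 𝓝 z, dist w z < 1 := ball_mem_nhds z one_pos
  filter_upwards [h1, h2] with w hw1 hw2 b hbB hwb
  refine hw1 b ⟨hbB, ?_⟩ hwb
  rw [mem_closedBall]
  have hb1 : dist w b ≤ dist w b₁ := hwb b₁ (Or.inl hb₁)
  calc dist b z ≤ dist w b + dist w z := dist_triangle_left _ _ _
    _ ≤ dist w b₁ + dist w z := by gcongr
    _ ≤ (dist w z + dist z b₁) + dist w z := by gcongr; exact dist_triangle _ _ _
    _ ≤ 2 + dist z b₁ := by linarith [hw2.le]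

/-- **Unfolding a reflexive-transitive closure into a tuple**: if `c` is reachable from `a` by
`r`-steps, there is a tuple `f : Fin (k + 1) → α` from `f 0 = a` to `f (Fin.last k) = c` with
`r (f i) (f (i+1))` for all `i < k`. -/
theorem bpc_chain_of_reflTransGen {α : Type*} {r : α → α → Prop} {a c : α}
    (h : Relation.ReflTransGen r a c) :
    ∃ (k : ℕ) (f : Fin (k + 1) → α), f 0 = a ∧ f (Fin.last k) = c ∧
      ∀ i : Fin k, r (f i.castSucc) (f i.succ) := by
  induction h using Relation.ReflTransGen.head_induction_on with
  | refl => exact ⟨0, fun _ => c, rfl, rfl, fun i => i.elim0⟩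
  | @head a' c' hac' _ ih =>
    obtain ⟨k, f, hf0, hfl, hstep⟩ := ih
    refine ⟨k + 1, Fin.cons a' f, rfl, ?_, fun i => ?_⟩
    · rw [← Fin.succ_last, Fin.cons_succ]
      exact hfl
    · refine Fin.cases ?_ (fun j => ?_) i
      · simp only [Fin.castSucc_zero, Fin.cons_zero, Fin.cons_succ, hf0]
        exact hac'
      · rw [← Fin.succ_castSucc, Fin.cons_succ, Fin.cons_succ]
        exact hstep j

/-- **A black path runs through a finite chain of black cells** (Bollobás–Riordan 2006, Ch. 8
§8.1): for `B` locally finite and `B`, `W` nonempty, a path `γ` from `x` to `y` inside the black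
region of `(B, W)` admits black nuclei `b 0, …, b k ∈ B` with `x ∈ cell (b 0)`,
`y ∈ cell (b k)`, and consecutive cells `cell (b i)`, `cell (b (i+1))` — closed Voronoi cells with
respect to all the nuclei `B ∪ W` — sharing a point of `γ`. -/
theorem blackPath_cellChain : ∀ (B W : Set ℂ) (x y : ℂ) (γ : Path x y), (∀ K : Set ℂ, IsCompact K → (B ∩ K).Finite) → B.Nonempty → W.Nonempty → (∀ t, γ t ∈ Literature.Probability.Percolation.blackRegion B W) → ∃ (k : ℕ) (b : Fin (k + 1) → ℂ), (∀ i, b i ∈ B) ∧ x ∈ Literature.Probability.LatticeModels.voronoiCell (B ∪ W) (b 0) ∧ y ∈ Literature.Probability.LatticeModels.voronoiCell (B ∪ W) (b (Fin.last k)) ∧ ∀ i : Fin k, ∃ t, γ t ∈ Literature.Probability.LatticeModels.voronoiCell (B ∪ W) (b i.castSucc) ∧ γ t ∈ Literature.Probability.LatticeModels.voronoiCell (B ∪ W) (b i.succ) := by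
  intro B W x y γ hB hBne hWne hγ
  -- adjacency of black nuclei: both black, cells sharing a point of the path
  set E : ℂ → ℂ → Prop := fun b b' => b ∈ B ∧ b' ∈ B ∧
    ∃ t, γ t ∈ voronoiCell (B ∪ W) b ∧ γ t ∈ voronoiCell (B ∪ W) b' with hE
  -- every point of the extended path is a path point, hence black, hence in a black cell
  have hext : ∀ s : ℝ, ∃ t, γ t = γ.extend s := fun s => by
    have h : γ.extend s ∈ range γ := by rw [← Path.extend_range]; exact mem_range_self s
    exact h
  have hcell : ∀ s : ℝ, ∃ b ∈ B, γ.extend s ∈ voronoiCell (B ∪ W) b := fun s => by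
    obtain ⟨t, ht⟩ := hext s
    rw [← ht]
    exact (mem_blackRegion_iff_exists_voronoiCell B W (γ t) hB hBne hWne).1 (hγ t)
  -- `P s s'`: every black cell at time `s` is chained to every black cell at time `s'`
  set P : ℝ → ℝ → Prop := fun s s' => ∀ b ∈ B, γ.extend s ∈ voronoiCell (B ∪ W) b →
    ∀ b' ∈ B, γ.extend s' ∈ voronoiCell (B ∪ W) b' → Relation.ReflTransGen E b b' with hP
  have hloc : ∀ s : ℝ, ∀ᶠ s' in 𝓝 s, P s s' ∧ P s' s := fun s => by
    have h := (γ.continuous_extend.tendsto s).eventually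
      (bpc_eventually_mem_voronoiCell W hB hBne (γ.extend s))
    filter_upwards [h] with s' hs'
    obtain ⟨t, ht⟩ := hext s
    refine ⟨fun b hbB hb b' hb'B hb' => ?_, fun b hbB hb b' hb'B hb' => ?_⟩
    · exact Relation.ReflTransGen.single ⟨hbB, hb'B, t, by rw [ht]; exact ⟨hb, hs' b' hb'B hb'⟩⟩
    · exact Relation.ReflTransGen.single ⟨hbB, hb'B, t, by rw [ht]; exact ⟨hs' b hbB hb, hb'⟩⟩
  have htrans : IsTrans ℝ P := ⟨fun s s' s'' h1 h2 b hbB hb b'' hb''B hb'' => by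
    obtain ⟨b', hb'B, hb'⟩ := hcell s'
    exact (h1 b hbB hb b' hb'B hb').trans (h2 b' hb'B hb' b'' hb''B hb'')⟩
  have hP01 : P 0 1 := PreconnectedSpace.induction₂' P hloc htrans 0 1
  obtain ⟨b₀, hb₀B, hb₀⟩ := hcell 0
  obtain ⟨b₁, hb₁B, hb₁⟩ := hcell 1
  have hRTG : Relation.ReflTransGen E b₀ b₁ := hP01 b₀ hb₀B hb₀ b₁ hb₁B hb₁
  rw [Path.extend_zero] at hb₀
  rw [Path.extend_one] at hb₁
  obtain ⟨k, f, hf0, hfl, hstep⟩ := bpc_chain_of_reflTransGen hRTG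
  refine ⟨k, f, fun i => ?_, by rw [hf0]; exact hb₀, by rw [hfl]; exact hb₁,
    fun i => (hstep i).2.2⟩
  induction i using Fin.lastCases with
  | last => rw [hfl]; exact hb₁B
  | cast j => exact (hstep j).1

end Summit.CriticalPhenomena.CardyFormulaZ2.Cruxes.VoronoiHubFromSmirnov.MoebiusExactDelaunayDilationWard
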